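import Literature.NumberTheory.LFunctions.LevelOneCentralValuesWeightAspect
import Literature.NumberTheory.LFunctions.KMVMomentsToHalfEdge
import HarnessLib

/-!
# Level one, weight aspect: the three printed mollified-moment lemmas ⇒ the `1/5` non-vanishing
# theorem (Balkanova–Frolenkov 2021, proof of Theorem 8.7, run in the kernel)

Topic `Literature/NumberTheory/LFunctions` (cell `landau-siegel`, §C harvest, family route r7;
companion of `LevelOneCentralValuesWeightAspect.lean` (typer-1, T-022/023) and the weight-aspect twin
of `KMVMomentsToHalfEdge.lean` (B-fam, prime level)). PROOF-KIND FILE: no new definition, no new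
named fact. It proves the IMPLICATION printed as the proof of [BalkanovaFrolenkov2021, Thm 8.7]:

> "Asymptotic formulas for the first and second mollified moments are given by (8.?) [Lemma 8.3]
> and (8.?) [Lemma 8.5]. Accordingly, the largest admissible length of mollifier is `Δ < 1/4 − ε`.
> Applying the inequality (8.5) [Lemma 8.1], we estimate
> `M̃₁ := Σ^h M(f)L_f(1/2)δ_{L_f(1/2) < b(k)(log k)^{−1/2}} ≤ … ≤ b(k)`. Taking `b(k) = (log k)^{−3/2}`
> we have `Σ^h_{L_f(1/2) ≥ (log k)^{−2}} 1 ≥ (M₁ − M̃₁)²/M₂ ≥ Δ/(1+Δ)` for any `Δ < 1/4 − ε`. The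
> result follows." [held e-print arXiv:1610.03465v3, ll. 2259–2279; = JEMS 23 (2021) §8.3]

in the typed vocabulary of `LevelOneCentralValuesWeightAspect.lean`:

* `LevelOneCentralValues.balkanovaFrolenkov2021_theorem87_of_lemmas` — the named facts
  `balkanovaFrolenkov2021_lemma81` (`Σ^h M² ≪ log M`), `…_lemma83` (`M₁ = 4ζ(2)/log M + O(log⁻²M)`),
  `…_lemma85` (`M₂ = 16ζ(2)²(1+1/Δ)/log²M + O(log⁻³M)`, `Δ < 1/4`) IMPLY the named fact
  `balkanovaFrolenkov2021_theorem87` (`Σ^h_{L_f(1/2) ≥ (log k)⁻²} 1 ≥ 1/5 − ε`), GIVEN the four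
  standard inputs the printed proof uses silently and for which the level-one (`𝒮ℒ`) vocabulary of
  that file has no declaration: (hfin) the Hecke basis `H_k(1)` is finite; (hmass) the total harmonic
  mass `Σ^h_{f ∈ H_{2k}(1)} 1` is bounded for large `k` (Petersson's formula with `m = n = 1`,
  [BalkanovaFrolenkov2021, §2 (2.14)]); (hreal) the Hecke eigenvalues `λ_f(n)` of a primitive form are
  real; (hKZ) `L_f(1/2)` is real and `≥ 0` (Kohnen–Zagier / Waldspurger, quoted in
  [BalkanovaFrolenkov2021] via [IS, KMV]). These are DISPLAYED hypotheses, not new facts.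
* The Cauchy–Schwarz-with-floor step and the scalar limit are NOT re-proved: they are the cell's
  `ThresholdCS.floor_cauchySchwarz` and `ThresholdCS.eventual_ratio_lower_bound`
  (`KMVMomentsToHalfEdge.lean` §1, §4), instantiated with `Qh = 1`, `α = ζ(2)`, `c₁ = 4`,
  `c₂ = 8(1 + 1/Δ)`, `x = log k` — so `c₁²/(2c₂) = Δ/(1+Δ)`, the printed value, and `Δ = 1/4 − ε/2`
  gives `≥ 1/5 − ε`.
* `LevelOneCentralValues.harmonicWeight_nonneg` — `ω_f ≥ 0` for weight `≥ 2` (proved outright: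
  `Γ(k−1) > 0`, `(4π)^{k−1} > 0`, the Petersson double integral of `‖f‖²y^{k−2}` is `≥ 0`).
* `LevelOneCentralValues.ratio_ge_fifth` — the arithmetic of the edge: for `0 < ε < 1/5`,
  `Δ = 1/4 − ε/2` has `Δ/(1+Δ) − ε/2 ≥ 1/5 − ε`.

WHAT THIS IS NOT. No claim that Lemmas 8.1/8.3/8.5 hold (they stay named facts, theorem-in-print),
nothing about `Δ ≥ 1/4`, nothing about Landau–Siegel zeros. «The programme SEARCHES and TYPES; no
claim about Landau–Siegel zeros, Theorems 1–2 of arXiv:2211.02515 or a repaired Margin232 until a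
kernel theorem says so.»

## Versions
* v1 (p488169): §1–§2.
* v2 (Part 2, appended; §1–§2 byte-identical): §3 `balkanovaFrolenkov2021_theorem88_pos_of_lemmas`,
  `balkanovaFrolenkov2021_theorem88'_of_lemmas` and the window/finsum bookkeeping lemmas.

## References
* [BalkanovaFrolenkov2021] O. Balkanova, D. Frolenkov, *Moments of L-functions and the
  Liouville–Green method*, J. Eur. Math. Soc. 23 (2021) 1333–1380 = arXiv:1610.03465 (v3), §8:
  Lemmas 8.1, 8.3, 8.5, Theorem 8.7 and its proof. [held: paper:arxiv-1610.03465; e-print v3 read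
  2026-08-27, ll. 1992–2279]
* [KowalskiMichelVanderKam2000] E. Kowalski, P. Michel, J. VanderKam, J. reine angew. Math. 526
  (2000), §1 (after (7)) — the Cauchy–Schwarz step (tree: `ThresholdCS.*`).
-/

noncomputable section

open scoped Classical MatrixGroups
open Complex Filter MeasureTheory Finset

namespace Literature.NumberTheory.LFunctions

namespace LevelOneCentralValues

/-! ## §1. Bookkeeping in the level-one vocabulary -/

/-- The Petersson norm integral `∫_{−1/2}^{1/2} ∫_{√(1−x²)}^∞ ‖f(x+iy)‖² y^{k−2} dy dx` is `≥ 0`.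
[cite: BalkanovaFrolenkov2021, §2 (2.12)] -/
theorem peterssonNormSq_nonneg {k : ℤ} (f : CuspForm 𝒮ℒ k) : 0 ≤ peterssonNormSq f := by
  unfold peterssonNormSq
  refine setIntegral_nonneg measurableSet_Icc fun x _ => ?_
  refine setIntegral_nonneg measurableSet_Ioi fun y hy => ?_
  have hy0 : 0 ≤ y := le_trans (Real.sqrt_nonneg _) (le_of_lt hy)
  exact mul_nonneg (sq_nonneg _) (Real.rpow_nonneg hy0 _)

/-- The harmonic weight `ω_f = Γ(k−1)/((4π)^{k−1}⟨f,f⟩)` is `≥ 0` for weight `k ≥ 2`.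
[cite: BalkanovaFrolenkov2021, §2 (2.12)] -/
theorem harmonicWeight_nonneg {k : ℤ} (hk : 2 ≤ k) (f : CuspForm 𝒮ℒ k) :
    0 ≤ harmonicWeight f := by
  unfold harmonicWeight
  have hk' : (0 : ℝ) < (k : ℝ) - 1 := by
    have : (2 : ℝ) ≤ (k : ℝ) := by exact_mod_cast hk
    linarith
  refine div_nonneg (Real.Gamma_pos_of_pos hk').le ?_
  exact mul_nonneg (Real.rpow_pos_of_pos (by positivity) _).le (peterssonNormSq_nonneg f)

/-- The mollifier `M(f)` of a form with real Hecke eigenvalues is real.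
[cite: BalkanovaFrolenkov2021, §8.1 (8.1)–(8.3)] -/
theorem mollifierValue_im_eq_zero {k : ℤ} {f : CuspForm 𝒮ℒ k}
    (hreal : ∀ n : ℕ, (heckeLambda f n).im = 0) (M : ℝ) : (mollifierValue M f).im = 0 := by
  unfold mollifierValue
  rw [Complex.im_sum]
  refine Finset.sum_eq_zero fun m _ => ?_
  rw [Complex.im_ofReal_mul, hreal m, mul_zero]

/-- A complex number with zero imaginary part is the cast of its real part. [folklore] -/
private theorem eq_ofReal_re_of_im_eq_zero {z : ℂ} (hz : z.im = 0) : z = ((z.re : ℝ) : ℂ) :=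
  Complex.ext (by simp) (by simp [hz])

/-- The harmonic sum as a `Finset` sum over the (finite) Hecke basis.
[cite: BalkanovaFrolenkov2021, §2 (2.13)] -/
theorem harmonicSum_eq_sum {k : ℤ} (hfin : (primitiveForms k).Finite) (α : CuspForm 𝒮ℒ k → ℂ) :
    harmonicSum k α = ∑ f ∈ hfin.toFinset, (harmonicWeight f : ℂ) * α f := by
  unfold harmonicSum
  exact finsum_mem_eq_finite_toFinset_sum _ hfin

/-- The arithmetic of the individual-weight edge: with `Δ = 1/4 − ε/2` (`0 < ε < 1/5`) the
Cauchy–Schwarz value `Δ/(1+Δ)` loses at most `ε/2` against `1/5 = (1/4)/(1+1/4)`.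
[cite: BalkanovaFrolenkov2021, proof of Theorem 8.7 (Δ/(1+Δ), Δ < 1/4 − ε)] -/
theorem ratio_ge_fifth {ε : ℝ} (hε : 0 < ε) (hε' : ε < 1 / 5) :
    1 / 5 - ε ≤ (1 / 4 - ε / 2) / (1 + (1 / 4 - ε / 2)) - ε / 2 := by
  have hpos : 0 < 1 + (1 / 4 - ε / 2) := by linarith
  rw [le_sub_iff_add_le, le_div_iff₀ hpos]
  nlinarith

/-! ## §2. The bridge: Lemmas 8.1, 8.3, 8.5 ⇒ Theorem 8.7 -/

/-- **Balkanova–Frolenkov 2021, Theorem 8.7 from Lemmas 8.1, 8.3, 8.5** (the printed proof, run in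
the kernel). Displayed standard inputs: `hfin` (finite Hecke basis), `hmass` (bounded total harmonic
mass for large even weight), `hreal` (real Hecke eigenvalues of primitive forms), `hKZ` (`L_f(1/2)`
real and non-negative). Conclusion: the named fact `balkanovaFrolenkov2021_theorem87`, i.e. for
every `ε > 0`, `Σ^h_{f ∈ H_{2k}(1), L_f(1/2) ≥ (log k)⁻²} 1 ≥ 1/5 − ε` for all large even `k`.
[cite: BalkanovaFrolenkov2021, Theorem 8.7 and its proof (§8.3); Lemmas 8.1, 8.3, 8.5] -/
theorem balkanovaFrolenkov2021_theorem87_of_lemmas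
    (h81 : balkanovaFrolenkov2021_lemma81) (h83 : balkanovaFrolenkov2021_lemma83)
    (h85 : balkanovaFrolenkov2021_lemma85)
    (hfin : ∀ k : ℤ, (primitiveForms k).Finite)
    (hmass : ∃ Cw : ℝ, ∃ kw : ℕ, ∀ k : ℕ, kw ≤ k →
      ∑ᶠ f ∈ primitiveForms (2 * (k : ℤ)), harmonicWeight f ≤ Cw)
    (hreal : ∀ (k : ℤ) (f : CuspForm 𝒮ℒ k), f ∈ primitiveForms k → ∀ n : ℕ, (heckeLambda f n).im = 0)
    (hKZ : ∀ (k : ℤ) (f : CuspForm 𝒮ℒ k), f ∈ primitiveForms k →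
      (centralValue f).im = 0 ∧ 0 ≤ (centralValue f).re) :
    balkanovaFrolenkov2021_theorem87 := by
  intro ε hε
  -- harmonic weights are non-negative in weight `2k ≥ 2`
  have hω : ∀ k : ℕ, 1 ≤ k → ∀ f : CuspForm 𝒮ℒ (2 * (k : ℤ)), 0 ≤ harmonicWeight f := by
    intro k hk f
    exact harmonicWeight_nonneg (by omega) f
  -- the conclusion is a sum of non-negative terms: trivial when `ε ≥ 1/5`
  rcases le_or_gt (1 / 5) ε with hbig | hbig
  · refine ⟨1, fun k hk _ => ?_⟩
    have h0 : 0 ≤ ∑ᶠ f ∈ largeValueForms (2 * (k : ℤ)) (1 / Real.log k ^ 2), harmonicWeight f :=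
      finsum_nonneg fun f => finsum_nonneg fun _ => hω k hk f
    linarith
  -- mollifier exponent `Δ = 1/4 − ε/2`
  set Δ : ℝ := 1 / 4 - ε / 2 with hΔ_def
  have hΔ0 : 0 < Δ := by rw [hΔ_def]; linarith
  have hΔ1 : Δ < 1 - 1 / 2 := by rw [hΔ_def]; linarith
  have hΔ5 : Δ < 1 / 4 - ε / 4 := by rw [hΔ_def]; linarith
  -- the three printed lemmas at this `Δ`
  obtain ⟨k₁, C₁, H1⟩ := h81 (1 / 2) Δ (by norm_num) hΔ0 hΔ1
  obtain ⟨k₃, C₃, H3⟩ := h83 (1 / 2) Δ (by norm_num) hΔ0 hΔ1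
  obtain ⟨k₅, C₅, H5⟩ := h85 (ε / 4) Δ (by linarith) hΔ0 hΔ5
  obtain ⟨Cw, kw, Hw⟩ := hmass
  -- non-negative versions of the constants
  set C₁' : ℝ := max C₁ 0 with hC₁'
  set Cw' : ℝ := max Cw 0 with hCw'
  have hC₁'0 : 0 ≤ C₁' := le_max_right _ _
  have hCw'0 : 0 ≤ Cw' := le_max_right _ _
  -- the scalar endgame (KMV's ratio lemma with `Qh = 1`, `α = ζ(2)`, `c₁ = 4`, `c₂ = 8(1+1/Δ)`)
  have hz : 0 < zetaTwo := by unfold zetaTwo; positivity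
  have hc₂ : 0 < 8 * (1 + 1 / Δ) := by positivity
  obtain ⟨x₀, hx₀1, Hx⟩ := ThresholdCS.eventual_ratio_lower_bound (α := zetaTwo) (c₁ := 4)
    (c₂ := 8 * (1 + 1 / Δ)) (Δ := Δ) (ε := ε / 2) (C₃ / Δ ^ 2) (C₅ / Δ ^ 3)
    (Real.sqrt (Cw' * (C₁' * Δ))) hz (by norm_num) hc₂ hΔ0 (by linarith)
  -- the threshold in `k`
  refine ⟨max (max (max k₁ k₃) (max k₅ kw)) (max 2 ⌈Real.exp x₀⌉₊), fun k hk hkev => ?_⟩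
  have hk₁ : k₁ ≤ k := le_trans (le_trans (le_max_left _ _) (le_max_left _ _)) (le_trans (le_max_left _ _) hk)
  have hk₃ : k₃ ≤ k := le_trans (le_trans (le_max_right _ _) (le_max_left _ _)) (le_trans (le_max_left _ _) hk)
  have hk₅ : k₅ ≤ k := le_trans (le_trans (le_max_left _ _) (le_max_right _ _)) (le_trans (le_max_left _ _) hk)
  have hkw : kw ≤ k := le_trans (le_trans (le_max_right _ _) (le_max_right _ _)) (le_trans (le_max_left _ _) hk)
  have hk2 : 2 ≤ k := le_trans (le_max_left _ _) (le_trans (le_max_right _ _) hk)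
  have hkexp : ⌈Real.exp x₀⌉₊ ≤ k := le_trans (le_max_right _ _) (le_trans (le_max_right _ _) hk)
  have hkpos : (0 : ℝ) < k := by exact_mod_cast (lt_of_lt_of_le (by norm_num) hk2 : 0 < k)
  -- `x = log k ≥ x₀ ≥ 1`
  set x : ℝ := Real.log k with hx_def
  have hxx₀ : x₀ ≤ x := by
    rw [hx_def, Real.le_log_iff_exp_le hkpos]
    exact le_trans (Nat.le_ceil _) (by exact_mod_cast hkexp)
  have hx1 : 1 ≤ x := le_trans hx₀1 hxx₀
  have hx0 : 0 < x := by linarith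
  have hlogM : Real.log ((k : ℝ) ^ Δ) = Δ * x := by rw [hx_def, Real.log_rpow hkpos]
  have hΔx : 0 < Δ * x := mul_pos hΔ0 hx0
  -- the finite family, its weights, values and mollifiers
  set K : ℤ := 2 * (k : ℤ) with hK_def
  set s : Finset (CuspForm 𝒮ℒ K) := (hfin K).toFinset with hs_def
  have hmem : ∀ f, f ∈ s ↔ f ∈ primitiveForms K := fun f => Set.Finite.mem_toFinset _
  set w : CuspForm 𝒮ℒ K → ℝ := fun f => harmonicWeight f with hw_def
  set a : CuspForm 𝒮ℒ K → ℂ := fun f => centralValue f with ha_def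
  set M : ℝ := (k : ℝ) ^ Δ with hM_def
  set m : CuspForm 𝒮ℒ K → ℂ := fun f => mollifierValue M f with hm_def
  have hw : ∀ f ∈ s, 0 ≤ w f := fun f _ => hω k (le_trans (by norm_num) hk2) f
  have ha_re : ∀ f ∈ s, a f = (((a f).re : ℝ) : ℂ) := fun f hf =>
    eq_ofReal_re_of_im_eq_zero ((hKZ K f ((hmem f).1 hf)).1)
  have ha_nn : ∀ f ∈ s, 0 ≤ (a f).re := fun f hf => (hKZ K f ((hmem f).1 hf)).2
  have hm_re : ∀ f ∈ s, m f = (((m f).re : ℝ) : ℂ) := fun f hf =>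
    eq_ofReal_re_of_im_eq_zero (mollifierValue_im_eq_zero (hreal K f ((hmem f).1 hf)) M)
  have ha_norm : ∀ f ∈ s, ‖a f‖ = (a f).re := fun f hf => by
    rw [ha_re f hf, Complex.norm_real, Real.norm_eq_abs, abs_of_nonneg (by simpa using ha_nn f hf)]
    simp
  -- the real quantities of the endgame
  set S1 : ℝ := ‖∑ f ∈ s, (w f : ℂ) * a f * m f‖ with hS1_def
  set N1 : ℝ := ∑ f ∈ s, w f * ‖m f‖ with hN1_def
  set N2 : ℝ := ∑ f ∈ s, w f * ‖m f‖ ^ 2 with hN2_def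
  set W : ℝ := ∑ f ∈ s, w f with hW_def
  set Q : ℝ := ∑ f ∈ s, w f * ‖a f * m f‖ ^ 2 with hQ_def
  set τ : ℝ := x⁻¹ ^ 2 with hτ_def
  set g : ℝ := ∑ f ∈ s with τ ≤ ‖a f‖, w f with hg_def
  have hτ0 : 0 ≤ τ := by positivity
  have hW0 : 0 ≤ W := Finset.sum_nonneg hw
  have hN20 : 0 ≤ N2 := Finset.sum_nonneg fun f hf => mul_nonneg (hw f hf) (sq_nonneg _)
  -- (i) the first mollified moment: `S1 = ‖M₁‖ ≥ 4ζ(2)/(Δx) − C₃/(Δx)²`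
  have hM1 : harmonicSum K (fun f => mollifierValue M f * centralValue f) =
      ∑ f ∈ s, (w f : ℂ) * a f * m f := by
    rw [harmonicSum_eq_sum (hfin K)]
    refine Finset.sum_congr rfl fun f _ => ?_
    simp only [hw_def, ha_def, hm_def]
    ring
  have hS1 : zetaTwo * (Real.sqrt 1 / (Δ * x)) * |(4 : ℝ)| - C₃ / Δ ^ 2 * Real.sqrt 1 * x⁻¹ ^ 2 ≤ S1 := by
    have h3 := H3 k hk₃ hkev
    rw [hlogM, hM1] at h3
    -- `‖z − c‖ ≤ r ⇒ ‖z‖ ≥ ‖c‖ − r`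
    have hc : ‖((4 * zetaTwo / (Δ * x) : ℝ) : ℂ)‖ = 4 * zetaTwo / (Δ * x) := by
      rw [Complex.norm_real, Real.norm_eq_abs, abs_of_nonneg (by positivity)]
    have htri := norm_sub_norm_le (((4 * zetaTwo / (Δ * x) : ℝ) : ℂ)) (∑ f ∈ s, (w f : ℂ) * a f * m f)
    rw [norm_sub_rev] at htri
    have e1 : zetaTwo * (Real.sqrt 1 / (Δ * x)) * |(4 : ℝ)| = 4 * zetaTwo / (Δ * x) := by
      rw [Real.sqrt_one, abs_of_pos (by norm_num : (0:ℝ) < 4)]; ring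
    have e2 : C₃ / Δ ^ 2 * Real.sqrt 1 * x⁻¹ ^ 2 = C₃ * (Δ * x)⁻¹ ^ 2 := by
      rw [Real.sqrt_one]; field_simp
    rw [e1, e2, hS1_def]
    linarith [hc]
  -- (ii) the mollifier norm: `N2 = ‖Σ^h M²‖ ≤ C₁ Δ x`, and the floor correction `τ N1 ≤ τ √W √N2`
  have hM2sq : harmonicSum K (fun f => mollifierValue M f ^ 2) = ((N2 : ℝ) : ℂ) := by
    rw [harmonicSum_eq_sum (hfin K), hN2_def, Complex.ofReal_sum]
    refine Finset.sum_congr rfl fun f hf => ?_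
    obtain ⟨r, hr⟩ : ∃ r : ℝ, m f = (r : ℂ) := ⟨(m f).re, hm_re f hf⟩
    have e1 : mollifierValue M f = (r : ℂ) := hr
    rw [hr, e1, Complex.norm_real, Real.norm_eq_abs, sq_abs]
    push_cast
    rfl
  have hN2 : N2 ≤ C₁' * (Δ * x) := by
    have h1 := H1 k hk₁ hkev
    rw [hlogM, hM2sq, Complex.norm_real, Real.norm_eq_abs, abs_of_nonneg hN20] at h1
    exact le_trans h1 (mul_le_mul_of_nonneg_right (le_max_left _ _) hΔx.le)
  have hWle : W ≤ Cw' := by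
    have h := Hw k hkw
    rw [finsum_mem_eq_finite_toFinset_sum _ (hfin K)] at h
    exact le_trans h (le_max_left _ _)
  have ht : τ * N1 ≤ Real.sqrt 1 * x⁻¹ ^ 2 * (Real.sqrt (Cw' * (C₁' * Δ)) * Real.sqrt x) := by
    have hcs := ThresholdCS.sum_mul_norm_le_sqrt_mul_sqrt s hw m
    have h1 : Real.sqrt W ≤ Real.sqrt Cw' := Real.sqrt_le_sqrt hWle
    have h2 : Real.sqrt N2 ≤ Real.sqrt (C₁' * (Δ * x)) := Real.sqrt_le_sqrt hN2
    have h3 : N1 ≤ Real.sqrt Cw' * Real.sqrt (C₁' * (Δ * x)) :=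
      le_trans hcs (mul_le_mul h1 h2 (Real.sqrt_nonneg _) (Real.sqrt_nonneg _))
    have e : Real.sqrt Cw' * Real.sqrt (C₁' * (Δ * x)) = Real.sqrt (Cw' * (C₁' * Δ)) * Real.sqrt x := by
      rw [← Real.sqrt_mul hCw'0, ← Real.sqrt_mul (by positivity)]
      ring_nf
    rw [Real.sqrt_one, one_mul]
    calc τ * N1 ≤ τ * (Real.sqrt Cw' * Real.sqrt (C₁' * (Δ * x))) :=
          mul_le_mul_of_nonneg_left h3 hτ0
      _ = x⁻¹ ^ 2 * (Real.sqrt (Cw' * (C₁' * Δ)) * Real.sqrt x) := by rw [e]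
  -- (iii) the second mollified moment: `Q` real, two-sided around `16ζ(2)²(1+1/Δ)/(Δx)²`
  have hM2 : harmonicSum K (fun f => mollifierValue M f ^ 2 * centralValue f ^ 2) = ((Q : ℝ) : ℂ) := by
    rw [harmonicSum_eq_sum (hfin K), hQ_def, Complex.ofReal_sum]
    refine Finset.sum_congr rfl fun f hf => ?_
    obtain ⟨r, hr⟩ : ∃ r : ℝ, m f = (r : ℂ) := ⟨(m f).re, hm_re f hf⟩
    obtain ⟨t, ht'⟩ : ∃ t : ℝ, a f = (t : ℂ) := ⟨(a f).re, ha_re f hf⟩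
    have e1 : mollifierValue M f = (r : ℂ) := hr
    have e2 : centralValue f = (t : ℂ) := ht'
    rw [hr, ht', e1, e2, norm_mul, mul_pow, Complex.norm_real, Complex.norm_real, Real.norm_eq_abs,
      Real.norm_eq_abs, sq_abs, sq_abs]
    push_cast
    simp only [hw_def]
    ring
  have hQ2 : |Q - 16 * zetaTwo ^ 2 / (Δ * x) ^ 2 * (1 + 1 / Δ)| ≤ C₅ * (Δ * x)⁻¹ ^ 3 := by
    have h5 := H5 k hk₅ hkev
    rw [hlogM, hM2, ← Complex.ofReal_sub, Complex.norm_real, Real.norm_eq_abs] at h5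
    exact h5
  have emain : 2 * zetaTwo ^ 2 * (1 / (Δ ^ 2 * x ^ 2)) * (8 * (1 + 1 / Δ)) =
      16 * zetaTwo ^ 2 / (Δ * x) ^ 2 * (1 + 1 / Δ) := by
    field_simp
    ring
  have eerr : C₅ / Δ ^ 3 * 1 * x⁻¹ ^ 3 = C₅ * (Δ * x)⁻¹ ^ 3 := by
    field_simp
  have hQlo : 2 * zetaTwo ^ 2 * (1 / (Δ ^ 2 * x ^ 2)) * (8 * (1 + 1 / Δ)) - C₅ / Δ ^ 3 * 1 * x⁻¹ ^ 3 ≤ Q := by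
    rw [emain, eerr]; linarith [(abs_le.1 hQ2).1]
  have hQhi : Q ≤ 2 * zetaTwo ^ 2 * (1 / (Δ ^ 2 * x ^ 2)) * (8 * (1 + 1 / Δ)) + C₅ / Δ ^ 3 * 1 * x⁻¹ ^ 3 := by
    rw [emain, eerr]; linarith [(abs_le.1 hQ2).2]
  -- (iv) Cauchy–Schwarz with the floor `τ = (log k)⁻²`
  have hCS : τ * N1 ≤ S1 → (S1 - τ * N1) ^ 2 ≤ g * Q := fun hle =>
    ThresholdCS.floor_cauchySchwarz s hw a m hτ0 hle
  -- the endgame: `g ≥ Δ/(1+Δ) − ε/2`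
  have hg : (4 : ℝ) ^ 2 / (2 * (8 * (1 + 1 / Δ))) - ε / 2 ≤ g := by
    have := Hx x hxx₀ 1 S1 (τ * N1) Q g one_pos hS1 ht hQlo hQhi hCS
    exact this
  have eratio : (4 : ℝ) ^ 2 / (2 * (8 * (1 + 1 / Δ))) = Δ / (1 + Δ) := by
    field_simp
    ring
  -- (v) `g` is the harmonic mass of `{L_f(1/2) ≥ (log k)⁻²}`
  have hLV : largeValueForms K (1 / Real.log k ^ 2) =
      ↑(s.filter fun f => τ ≤ ‖a f‖) := by
    ext f
    simp only [largeValueForms, Set.mem_setOf_eq, Finset.coe_filter, hmem]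
    constructor
    · rintro ⟨hf, hle⟩
      refine ⟨hf, ?_⟩
      rw [ha_norm f ((hmem f).2 hf), hτ_def, hx_def, inv_pow, ← one_div]
      exact hle
    · rintro ⟨hf, hle⟩
      refine ⟨hf, ?_⟩
      rw [ha_norm f ((hmem f).2 hf), hτ_def, hx_def, inv_pow, ← one_div] at hle
      exact hle
  have hgsum : ∑ᶠ f ∈ largeValueForms K (1 / Real.log k ^ 2), harmonicWeight f = g := by
    rw [hLV, finsum_mem_coe_finset]
  rw [hgsum]
  calc 1 / 5 - ε ≤ Δ / (1 + Δ) - ε / 2 := ratio_ge_fifth hε hbig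
    _ = (4 : ℝ) ^ 2 / (2 * (8 * (1 + 1 / Δ))) - ε / 2 := by rw [eratio]
    _ ≤ g := hg

/-! ## §3 (Part 2, appended 2026-08-27; §1–§2 byte-identical). Lemmas 8.2, 8.4, 8.6 ⇒ Theorem 8.8
(the `1/2 − ε` weight-average record, Iwaniec–Sarnak's (1.1) in harmonic smooth form), with the
paper's standing normalisation `H = ∫ h > 0` explicit — the corrected typing
`balkanovaFrolenkov2021_theorem88'` (T-023′; the first typing admitted `h ≡ 0` and is refuted in
`LevelOneCentralValuesWeightAspectErratum.lean`). Printed proof followed: [BalkanovaFrolenkov2021,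
§8.4, arXiv v3 ll. 2282–2313] — "Σ_k h(4k/K) ∼ HK/4"; "C–S and (8.?) [Lemma 8.2] yield
Ã₁ ≪ K b(k)"; "choosing b(k) = (log k)^{−3/2} and applying the Cauchy–Schwarz inequality twice";
value `Δ/(1+Δ)` for any `Δ < 1 − ε`. Deviation (bookkeeping only): one floor `τ_K = 4(log K)⁻²`
serves all weights `4k` in the window `θ₁K/4 ≤ k ≤ θ₂K/4` once `θ₁K/4 ≥ √K` (then
`(log k)⁻² ≤ τ_K`), so the single-threshold Cauchy–Schwarz lemma `ThresholdCS.floor_cauchySchwarz`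
applies to the pairs `(k, f)` and the per-weight good sets only grow; the scalar limit is
`ThresholdCS.eventual_ratio_lower_bound` with `Qh = (HK/4)²`, `α = ζ(2)`, `c₁ = 4`, `c₂ = 8(1+1/Δ)`,
applied to the normalised mass `(4/(HK))·G` against `(HK/4)·A₂`. -/

/-- A §7 weight test function vanishes off `[θ₁, θ₂]` and is bounded.
[cite: BalkanovaFrolenkov2021, §7 (7.1)] -/
theorem IsWeightTest.exists_window_bound {h : ℝ → ℝ} (hh : IsWeightTest h) :
    ∃ θ₁ θ₂ B : ℝ, 0 < θ₁ ∧ θ₁ < θ₂ ∧ 0 ≤ B ∧ (∀ y, h y ≠ 0 → θ₁ ≤ y ∧ y ≤ θ₂) ∧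
      ∀ y, h y ≤ B := by
  obtain ⟨hcd, hnn, θ₁, θ₂, hθ₁, hθ₁₂, hsub⟩ := hh
  have hcs : HasCompactSupport h :=
    IsCompact.of_isClosed_subset isCompact_Icc (isClosed_tsupport _) hsub
  obtain ⟨C, hC⟩ := hcd.continuous.bounded_above_of_compact_support hcs
  refine ⟨θ₁, θ₂, max C 0, hθ₁, hθ₁₂, le_max_right _ _, fun y hy => ?_, fun y => ?_⟩
  · have hy' : y ∈ tsupport h := by
      by_contra hcon
      exact hy (image_eq_zero_of_notMem_tsupport hcon)
    exact hsub hy'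
  · have := hC y
    rw [Real.norm_eq_abs, abs_of_nonneg (hnn y)] at this
    exact le_trans this (le_max_left _ _)


/-- Over a finite set of weights `k` carrying the support of `k ↦ h(4k/K)`, the smooth weight average
of harmonic sums is one `Finset` sum over the pairs `(k, f)`.
[cite: BalkanovaFrolenkov2021, §7 (7.3)–(7.4) and §2 (2.13)] -/
theorem weightAverage_harmonicSum_eq_sum (hfin : ∀ k : ℤ, (primitiveForms k).Finite)
    (h : ℝ → ℝ) (K : ℝ) (sK : Finset ℕ) (hsupp : ∀ k : ℕ, h (4 * (k : ℝ) / K) ≠ 0 → k ∈ sK)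
    (α : ∀ k : ℕ, CuspForm 𝒮ℒ (4 * (k : ℤ)) → ℂ) :
    weightAverage h K (fun k => harmonicSum (4 * (k : ℤ)) (α k)) =
      ∑ x ∈ sK.sigma (fun k => (hfin (4 * (k : ℤ))).toFinset),
        ((h (4 * (x.1 : ℝ) / K) * harmonicWeight x.2 : ℝ) : ℂ) * α x.1 x.2 := by
  unfold weightAverage
  rw [finsum_eq_sum_of_support_subset _ (s := sK) ?_]
  · rw [Finset.sum_sigma]
    refine Finset.sum_congr rfl fun k _ => ?_
    dsimp only
    rw [harmonicSum_eq_sum (hfin _), Finset.mul_sum]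
    refine Finset.sum_congr rfl fun f _ => ?_
    push_cast
    ring
  · intro k hk
    rw [Function.mem_support] at hk
    rw [Finset.mem_coe]
    by_contra hnot
    apply hk
    have : h (4 * (k : ℝ) / K) = 0 := by
      by_contra hne
      exact hnot (hsupp k hne)
    rw [this]
    simp

/-- The same for the real double sum of Theorem 8.8's left side (good mass with the per-weight floor
`(log k)⁻²`). [cite: BalkanovaFrolenkov2021, Theorem 8.8 (display)] -/
theorem weightAverage_goodMass_eq_sum (hfin : ∀ k : ℤ, (primitiveForms k).Finite)
    (h : ℝ → ℝ) (K : ℝ) (sK : Finset ℕ) (hsupp : ∀ k : ℕ, h (4 * (k : ℝ) / K) ≠ 0 → k ∈ sK) :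
    ∑ᶠ k : ℕ, h (4 * (k : ℝ) / K) *
        ∑ᶠ f ∈ largeValueForms (4 * (k : ℤ)) (1 / Real.log k ^ 2), harmonicWeight f =
      ∑ x ∈ (sK.sigma (fun k => (hfin (4 * (k : ℤ))).toFinset)) with
          1 / Real.log x.1 ^ 2 ≤ (centralValue x.2).re,
        h (4 * (x.1 : ℝ) / K) * harmonicWeight x.2 := by
  rw [finsum_eq_sum_of_support_subset _ (s := sK) ?_]
  · rw [Finset.sum_filter, Finset.sum_sigma]
    refine Finset.sum_congr rfl fun k _ => ?_
    have hLV : largeValueForms (4 * (k : ℤ)) (1 / Real.log k ^ 2) =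
        ↑((hfin (4 * (k : ℤ))).toFinset.filter fun f => 1 / Real.log k ^ 2 ≤ (centralValue f).re) := by
      ext f
      simp [largeValueForms, Set.Finite.mem_toFinset]
    rw [hLV, finsum_mem_coe_finset, Finset.sum_filter, Finset.mul_sum]
    refine Finset.sum_congr rfl fun f _ => ?_
    split_ifs <;> simp
  · intro k hk
    rw [Function.mem_support] at hk
    rw [Finset.mem_coe]
    by_contra hnot
    apply hk
    have : h (4 * (k : ℝ) / K) = 0 := by
      by_contra hne
      exact hnot (hsupp k hne)
    rw [this, zero_mul]

/-- The arithmetic of the averaged edge: with `Δ = 1 − ε` (`0 < ε < 1/2`) the Cauchy–Schwarz value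
`Δ/(1+Δ)` loses at most `ε/2` against `1/2 = 1/(1+1)`.
[cite: BalkanovaFrolenkov2021, proof of Theorem 8.8 (Δ/(1+Δ), Δ < 1 − ε)] -/
theorem ratio_ge_half {ε : ℝ} (hε : 0 < ε) (hε' : ε < 1 / 2) :
    1 / 2 - ε ≤ (1 - ε) / (1 + (1 - ε)) - ε / 2 := by
  have hpos : 0 < 1 + (1 - ε) := by linarith
  rw [le_sub_iff_add_le, le_div_iff₀ hpos]
  nlinarith

/-- **Balkanova–Frolenkov 2021, Theorem 8.8 from Lemmas 8.2, 8.4, 8.6** (the printed proof of the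
`1/2 − ε` weight-AVERAGE record — Iwaniec–Sarnak's (1.1) in harmonic smooth form — run in the
kernel), stated with the paper's standing normalisation `H = ∫ h > 0` made explicit
(`0 < weightMass h`; the typed `IsWeightTest` alone admits `h ≡ 0`). Displayed standard inputs as in
Part 1: `hfin`, `hmass` (now for every large weight), `hreal`, `hKZ`.
[cite: BalkanovaFrolenkov2021, Theorem 8.8 and its proof (§8.4, arXiv v3 ll. 2282–2313);
Lemmas 8.2, 8.4, 8.6; §7 (7.1)–(7.2)] -/
theorem balkanovaFrolenkov2021_theorem88_pos_of_lemmas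
    (h82 : balkanovaFrolenkov2021_lemma82) (h84 : balkanovaFrolenkov2021_lemma84)
    (h86 : balkanovaFrolenkov2021_lemma86)
    (hfin : ∀ k : ℤ, (primitiveForms k).Finite)
    (hmass : ∃ Cw : ℝ, ∃ kw : ℤ, ∀ k : ℤ, kw ≤ k →
      ∑ᶠ f ∈ primitiveForms k, harmonicWeight f ≤ Cw)
    (hreal : ∀ (k : ℤ) (f : CuspForm 𝒮ℒ k), f ∈ primitiveForms k → ∀ n : ℕ, (heckeLambda f n).im = 0)
    (hKZ : ∀ (k : ℤ) (f : CuspForm 𝒮ℒ k), f ∈ primitiveForms k →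
      (centralValue f).im = 0 ∧ 0 ≤ (centralValue f).re) :
    ∀ h : ℝ → ℝ, IsWeightTest h → 0 < weightMass h → ∀ ε : ℝ, 0 < ε → ∃ K₀ : ℝ, ∀ K : ℝ, K₀ ≤ K →
      1 / 2 - ε ≤ 4 / (weightMass h * K) *
        ∑ᶠ k : ℕ, h (4 * (k : ℝ) / K) *
          ∑ᶠ f ∈ largeValueForms (4 * (k : ℤ)) (1 / Real.log k ^ 2), harmonicWeight f := by
  intro h hh hH ε hε
  obtain ⟨θ₁, θ₂, B, hθ₁, hθ₁₂, hB0, hwin, hB⟩ := hh.exists_window_bound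
  have hnn : ∀ y, 0 ≤ h y := hh.2.1
  have hθ₂ : 0 < θ₂ := lt_trans hθ₁ hθ₁₂
  set H : ℝ := weightMass h with hH_def
  -- harmonic weights are non-negative in weight `4k ≥ 2`
  have hω : ∀ k : ℕ, 1 ≤ k → ∀ f : CuspForm 𝒮ℒ (4 * (k : ℤ)), 0 ≤ harmonicWeight f := by
    intro k hk f
    exact harmonicWeight_nonneg (by omega) f
  -- the normalised good mass is non-negative: the claim is trivial for `ε ≥ 1/2`
  have hG0 : ∀ K : ℝ, 0 < K → 0 ≤ 4 / (weightMass h * K) *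
      ∑ᶠ k : ℕ, h (4 * (k : ℝ) / K) *
        ∑ᶠ f ∈ largeValueForms (4 * (k : ℤ)) (1 / Real.log k ^ 2), harmonicWeight f := by
    intro K hK
    refine mul_nonneg (div_nonneg (by norm_num) (mul_nonneg hH.le hK.le)) ?_
    refine finsum_nonneg fun k => ?_
    by_cases hk : 1 ≤ k
    · exact mul_nonneg (hnn _) (finsum_nonneg fun f => finsum_nonneg fun _ => hω k hk f)
    · have hk0 : k = 0 := by omega
      subst hk0
      have hz : h (4 * ((0 : ℕ) : ℝ) / K) = 0 := by
        by_contra hne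
        have := (hwin _ hne).1
        simp at this
        linarith
      rw [hz, zero_mul]
  rcases le_or_gt (1 / 2) ε with hbig | hbig
  · exact ⟨1, fun K hK => le_trans (by linarith) (hG0 K (by linarith))⟩
  -- mollifier exponent `Δ = 1 − ε` (so that `Δ/(1+Δ) ≥ 1/2 − ε/2`)
  set Δ : ℝ := 1 - ε with hΔ_def
  have hΔ0 : 0 < Δ := by rw [hΔ_def]; linarith
  have hΔ1 : Δ < 1 - ε / 2 := by rw [hΔ_def]; linarith
  obtain ⟨K₂, C₂, H2⟩ := h82 h hh (ε / 2) Δ (by linarith) hΔ0 hΔ1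
  obtain ⟨K₄, C₄, H4⟩ := h84 h hh (ε / 2) Δ (by linarith) hΔ0 hΔ1
  obtain ⟨K₆, C₆, H6⟩ := h86 h hh (ε / 2) Δ (by linarith) hΔ0 hΔ1
  obtain ⟨Cw, kw, Hw⟩ := hmass
  set C₂' : ℝ := max C₂ 0 with hC₂'
  set Cw' : ℝ := max Cw 0 with hCw'
  have hC₂'0 : 0 ≤ C₂' := le_max_right _ _
  have hCw'0 : 0 ≤ Cw' := le_max_right _ _
  -- total weighted mass constant: `Σ_k h(4k/K) Σ^h 1 ≤ B · (θ₂ K/4 + 1) · Cw' ≤ (B Cw' θ₂) · K` for `K ≥ 4`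
  set CW : ℝ := B * Cw' * (θ₂ / 4 + 1) with hCW_def
  have hCW0 : 0 ≤ CW := mul_nonneg (mul_nonneg hB0 hCw'0) (by linarith)
  -- the scalar endgame with `Qh = (HK/4)²`
  have hz : 0 < zetaTwo := by unfold zetaTwo; positivity
  have hc₂ : 0 < 8 * (1 + 1 / Δ) := by positivity
  obtain ⟨x₀, hx₀1, Hx⟩ := ThresholdCS.eventual_ratio_lower_bound (α := zetaTwo) (c₁ := 4)
    (c₂ := 8 * (1 + 1 / Δ)) (Δ := Δ) (ε := ε / 2) (4 * C₄ / (H * Δ ^ 2)) (4 * C₆ / (H * Δ ^ 3))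
    (4 * 4 * Real.sqrt (CW * (C₂' * Δ)) / H) hz (by norm_num) hc₂ hΔ0 (by linarith)
  -- the threshold in `K`
  set kw' : ℝ := max (kw : ℝ) 2 with hkw'_def
  have hkw'2 : (2 : ℝ) ≤ kw' := le_max_right _ _
  set K₀ : ℝ := max (max (max K₂ K₄) (max K₆ (Real.exp x₀)))
    (max (max (16 / θ₁ ^ 2) (4 * kw' / θ₁)) 4) with hK₀_def
  refine ⟨K₀, fun K hK => ?_⟩
  have hK₂ : K₂ ≤ K := le_trans (le_trans (le_max_left _ _) (le_max_left _ _)) (le_trans (le_max_left _ _) hK)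
  have hK₄ : K₄ ≤ K := le_trans (le_trans (le_max_right _ _) (le_max_left _ _)) (le_trans (le_max_left _ _) hK)
  have hK₆ : K₆ ≤ K := le_trans (le_trans (le_max_left _ _) (le_max_right _ _)) (le_trans (le_max_left _ _) hK)
  have hKexp : Real.exp x₀ ≤ K := le_trans (le_trans (le_max_right _ _) (le_max_right _ _)) (le_trans (le_max_left _ _) hK)
  have hK16 : 16 / θ₁ ^ 2 ≤ K := le_trans (le_trans (le_max_left _ _) (le_max_left _ _)) (le_trans (le_max_right _ _) hK)
  have hKkw : 4 * kw' / θ₁ ≤ K := le_trans (le_trans (le_max_right _ _) (le_max_left _ _)) (le_trans (le_max_right _ _) hK)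
  have hK4 : (4 : ℝ) ≤ K := le_trans (le_max_right _ _) (le_trans (le_max_right _ _) hK)
  have hKpos : 0 < K := by linarith
  have hK1 : (1 : ℝ) ≤ K := by linarith
  -- `x = log K ≥ x₀ ≥ 1`
  set x : ℝ := Real.log K with hx_def
  have hxx₀ : x₀ ≤ x := by rw [hx_def, Real.le_log_iff_exp_le hKpos]; exact hKexp
  have hx1 : 1 ≤ x := le_trans hx₀1 hxx₀
  have hx0 : 0 < x := by linarith
  have hlogM : Real.log (K ^ Δ) = Δ * x := by rw [hx_def, Real.log_rpow hKpos]
  have hΔx : 0 < Δ * x := mul_pos hΔ0 hx0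
  have hHK : 0 < H * K / 4 := by positivity
  -- the window of weights: `θ₁ K/4 ≤ k ≤ θ₂ K/4`, and on it `log k ≥ x/2`
  have hsqrtK : Real.sqrt K ≤ θ₁ * K / 4 := by
    -- `16/θ₁² ≤ K` ⇒ `4/θ₁ ≤ √K` ⇒ `√K · √K ≤ (θ₁ K/4)·... `
    have h1 : 4 / θ₁ ≤ Real.sqrt K := by
      rw [Real.le_sqrt (by positivity) hKpos.le]
      have : (4 / θ₁) ^ 2 = 16 / θ₁ ^ 2 := by ring
      rw [this]; exact hK16
    have h2 : Real.sqrt K * Real.sqrt K = K := Real.mul_self_sqrt hKpos.le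
    have h3 : Real.sqrt K * (4 / θ₁) ≤ Real.sqrt K * Real.sqrt K :=
      mul_le_mul_of_nonneg_left h1 (Real.sqrt_nonneg _)
    rw [h2] at h3
    have h4 : Real.sqrt K * (4 / θ₁) = Real.sqrt K * 4 / θ₁ := by ring
    rw [h4, div_le_iff₀ hθ₁] at h3
    linarith
  have hwin_k : ∀ k : ℕ, θ₁ * K / 4 ≤ (k : ℝ) →
      (1 : ℝ) < k ∧ kw' ≤ k ∧ 1 / Real.log k ^ 2 ≤ x⁻¹ ^ 2 * 4 := by
    intro k hk
    have hkw'k : kw' ≤ (k : ℝ) := by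
      have : 4 * kw' / θ₁ * θ₁ / 4 ≤ K * θ₁ / 4 := by
        have := mul_le_mul_of_nonneg_right hKkw hθ₁.le
        linarith
      have e : 4 * kw' / θ₁ * θ₁ / 4 = kw' := by field_simp
      rw [e] at this
      linarith
    have hk1 : (1 : ℝ) < k := by linarith
    refine ⟨hk1, hkw'k, ?_⟩
    have hlogk : x / 2 ≤ Real.log k := by
      have h1 : Real.log (Real.sqrt K) = x / 2 := by
        rw [Real.log_sqrt hKpos.le, hx_def]
      rw [← h1]
      exact Real.log_le_log (Real.sqrt_pos.2 hKpos) (le_trans hsqrtK hk)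
    have hlogk0 : 0 < Real.log k := by linarith
    rw [div_le_iff₀ (pow_pos hlogk0 2)]
    have : x⁻¹ ^ 2 * 4 * Real.log (k : ℝ) ^ 2 = (2 * Real.log k / x) ^ 2 := by
      field_simp
      ring
    rw [this]
    have h2 : 1 ≤ 2 * Real.log k / x := by rw [le_div_iff₀ hx0]; linarith
    nlinarith
  -- the finite index set of pairs `(k, f)`
  set sK : Finset ℕ := Finset.Icc ⌈θ₁ * K / 4⌉₊ ⌊θ₂ * K / 4⌋₊ with hsK_def
  have hsupp : ∀ k : ℕ, h (4 * (k : ℝ) / K) ≠ 0 → k ∈ sK := by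
    intro k hk
    obtain ⟨h1, h2⟩ := hwin (4 * (k : ℝ) / K) hk
    rw [hsK_def, Finset.mem_Icc]
    constructor
    · apply Nat.ceil_le.2
      rw [le_div_iff₀ hKpos] at h1
      linarith
    · apply Nat.le_floor
      rw [div_le_iff₀ hKpos] at h2
      linarith
  have hsK_win : ∀ k ∈ sK, θ₁ * K / 4 ≤ (k : ℝ) := by
    intro k hk
    rw [hsK_def, Finset.mem_Icc] at hk
    exact le_trans (Nat.le_ceil _) (by exact_mod_cast hk.1)
  have hsK_card : (sK.card : ℝ) ≤ θ₂ * K / 4 + 1 := by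
    have h1 : sK.card ≤ ⌊θ₂ * K / 4⌋₊ + 1 := by
      rw [hsK_def, Nat.card_Icc]; omega
    have h2 : (⌊θ₂ * K / 4⌋₊ : ℝ) ≤ θ₂ * K / 4 :=
      Nat.floor_le (div_nonneg (mul_nonneg hθ₂.le hKpos.le) (by norm_num))
    calc (sK.card : ℝ) ≤ (⌊θ₂ * K / 4⌋₊ : ℝ) + 1 := by exact_mod_cast h1
      _ ≤ θ₂ * K / 4 + 1 := by linarith
  set S := sK.sigma (fun k => (hfin (4 * (k : ℤ))).toFinset) with hS_def
  have hmemS : ∀ x ∈ S, x.1 ∈ sK ∧ x.2 ∈ primitiveForms (4 * (x.1 : ℤ)) := by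
    intro x hx
    rw [hS_def, Finset.mem_sigma, Set.Finite.mem_toFinset] at hx
    exact hx
  set M : ℝ := K ^ Δ with hM_def
  set w : (Σ k : ℕ, CuspForm 𝒮ℒ (4 * (k : ℤ))) → ℝ :=
    fun y => h (4 * (y.1 : ℝ) / K) * harmonicWeight y.2 with hw_def
  set a : (Σ k : ℕ, CuspForm 𝒮ℒ (4 * (k : ℤ))) → ℂ := fun y => centralValue y.2 with ha_def
  set m : (Σ k : ℕ, CuspForm 𝒮ℒ (4 * (k : ℤ))) → ℂ := fun y => mollifierValue M y.2 with hm_def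
  have hk1_of : ∀ y ∈ S, 1 ≤ y.1 := by
    intro y hy
    have := (hwin_k y.1 (hsK_win y.1 (hmemS y hy).1)).1
    exact_mod_cast this.le
  have hw : ∀ y ∈ S, 0 ≤ w y := fun y hy =>
    mul_nonneg (hnn _) (hω y.1 (hk1_of y hy) y.2)
  have ha_re : ∀ y ∈ S, a y = (((a y).re : ℝ) : ℂ) := fun y hy =>
    eq_ofReal_re_of_im_eq_zero (hKZ _ y.2 (hmemS y hy).2).1
  have ha_nn : ∀ y ∈ S, 0 ≤ (a y).re := fun y hy => (hKZ _ y.2 (hmemS y hy).2).2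
  have hm_re : ∀ y ∈ S, m y = (((m y).re : ℝ) : ℂ) := fun y hy =>
    eq_ofReal_re_of_im_eq_zero (mollifierValue_im_eq_zero (hreal _ y.2 (hmemS y hy).2) M)
  have ha_norm : ∀ y ∈ S, ‖a y‖ = (a y).re := fun y hy => by
    rw [ha_re y hy, Complex.norm_real, Real.norm_eq_abs, abs_of_nonneg (by simpa using ha_nn y hy)]
    simp
  -- the real quantities of the endgame
  set S1 : ℝ := ‖∑ y ∈ S, (w y : ℂ) * a y * m y‖ with hS1_def
  set N1 : ℝ := ∑ y ∈ S, w y * ‖m y‖ with hN1_def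
  set N2 : ℝ := ∑ y ∈ S, w y * ‖m y‖ ^ 2 with hN2_def
  set W : ℝ := ∑ y ∈ S, w y with hW_def
  set Q : ℝ := ∑ y ∈ S, w y * ‖a y * m y‖ ^ 2 with hQ_def
  set τ : ℝ := x⁻¹ ^ 2 * 4 with hτ_def
  set g : ℝ := ∑ y ∈ S with τ ≤ ‖a y‖, w y with hg_def
  have hτ0 : 0 ≤ τ := by positivity
  have hW0 : 0 ≤ W := Finset.sum_nonneg hw
  have hN20 : 0 ≤ N2 := Finset.sum_nonneg fun y hy => mul_nonneg (hw y hy) (sq_nonneg _)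
  have hg0 : 0 ≤ g := Finset.sum_nonneg fun y hy => hw y (Finset.mem_filter.1 hy).1
  -- (i) the first mollified moment `A₁`
  have hA1 : weightAverage h K (fun k => harmonicSum (4 * (k : ℤ))
        (fun f => mollifierValue (K ^ Δ) f * centralValue f)) = ∑ y ∈ S, (w y : ℂ) * a y * m y := by
    rw [weightAverage_harmonicSum_eq_sum hfin h K sK hsupp]
    refine Finset.sum_congr rfl fun y _ => ?_
    simp only [hw_def, ha_def, hm_def, hM_def]
    ring
  have hS1 : zetaTwo * (Real.sqrt ((H * K / 4) ^ 2) / (Δ * x)) * |(4 : ℝ)| -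
      4 * C₄ / (H * Δ ^ 2) * Real.sqrt ((H * K / 4) ^ 2) * x⁻¹ ^ 2 ≤ S1 := by
    have h4 := H4 K hK₄
    rw [hlogM, hA1] at h4
    rw [Real.sqrt_sq hHK.le]
    have hc : ‖((weightMass h * K / 4 * (4 * zetaTwo / (Δ * x)) : ℝ) : ℂ)‖ =
        H * K / 4 * (4 * zetaTwo / (Δ * x)) := by
      rw [Complex.norm_real, Real.norm_eq_abs, abs_of_nonneg (by positivity)]
    have htri := norm_sub_norm_le (((weightMass h * K / 4 * (4 * zetaTwo / (Δ * x)) : ℝ) : ℂ))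
      (∑ y ∈ S, (w y : ℂ) * a y * m y)
    rw [norm_sub_rev, hc] at htri
    have e1 : zetaTwo * (H * K / 4 / (Δ * x)) * |(4 : ℝ)| = H * K / 4 * (4 * zetaTwo / (Δ * x)) := by
      rw [abs_of_pos (by norm_num : (0:ℝ) < 4)]; ring
    have e2 : 4 * C₄ / (H * Δ ^ 2) * (H * K / 4) * x⁻¹ ^ 2 = C₄ * K * (Δ * x)⁻¹ ^ 2 := by
      field_simp
    rw [e1, e2, hS1_def]
    linarith
  -- (ii) the mollifier norm `N2 = ‖A(M²)‖ ≤ C₂ K Δ x`, the total mass `W ≤ CW·K`, the floor term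
  have hA2sq : weightAverage h K (fun k => harmonicSum (4 * (k : ℤ))
        (fun f => mollifierValue (K ^ Δ) f ^ 2)) = ((N2 : ℝ) : ℂ) := by
    rw [weightAverage_harmonicSum_eq_sum hfin h K sK hsupp, hN2_def, Complex.ofReal_sum]
    refine Finset.sum_congr rfl fun y hy => ?_
    obtain ⟨r, hr⟩ : ∃ r : ℝ, m y = (r : ℂ) := ⟨(m y).re, hm_re y hy⟩
    have e1 : mollifierValue (K ^ Δ) y.2 = (r : ℂ) := hr
    rw [hr, e1, Complex.norm_real, Real.norm_eq_abs, sq_abs]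
    simp only [hw_def]
    push_cast
    ring
  have hN2 : N2 ≤ C₂' * K * (Δ * x) := by
    have h2 := H2 K hK₂
    rw [hlogM, hA2sq, Complex.norm_real, Real.norm_eq_abs, abs_of_nonneg hN20] at h2
    refine le_trans h2 ?_
    have : C₂ * K * (Δ * x) ≤ C₂' * K * (Δ * x) :=
      mul_le_mul_of_nonneg_right (mul_le_mul_of_nonneg_right (le_max_left _ _) hKpos.le) hΔx.le
    exact this
  have hWle : W ≤ CW * K := by
    have hinner : ∀ k ∈ sK, ∑ f ∈ (hfin (4 * (k : ℤ))).toFinset, harmonicWeight f ≤ Cw' := by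
      intro k hk
      obtain ⟨_, hkw'k, _⟩ := hwin_k k (hsK_win k hk)
      have hkwk : kw ≤ 4 * (k : ℤ) := by
        have h1 : (kw : ℝ) ≤ k := le_trans (le_max_left _ _) hkw'k
        have h2 : kw ≤ (k : ℤ) := by exact_mod_cast h1
        omega
      have := Hw (4 * (k : ℤ)) hkwk
      rw [finsum_mem_eq_finite_toFinset_sum _ (hfin _)] at this
      exact le_trans this (le_max_left _ _)
    have hstep : W ≤ ∑ k ∈ sK, B * Cw' := by
      rw [hW_def, hS_def, Finset.sum_sigma]
      refine Finset.sum_le_sum fun k hk => ?_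
      simp only [hw_def]
      rw [← Finset.mul_sum]
      exact mul_le_mul (hB _) (hinner k hk)
        (Finset.sum_nonneg fun f _ => hω k (by
          have := (hwin_k k (hsK_win k hk)).1; exact_mod_cast this.le) f) hB0
    rw [Finset.sum_const, nsmul_eq_mul] at hstep
    calc W ≤ (sK.card : ℝ) * (B * Cw') := hstep
      _ ≤ (θ₂ * K / 4 + 1) * (B * Cw') := mul_le_mul_of_nonneg_right hsK_card (mul_nonneg hB0 hCw'0)
      _ ≤ (θ₂ * K / 4 + K) * (B * Cw') := by
          apply mul_le_mul_of_nonneg_right _ (mul_nonneg hB0 hCw'0); linarith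
      _ = CW * K := by rw [hCW_def]; ring
  have ht : τ * N1 ≤ Real.sqrt ((H * K / 4) ^ 2) * x⁻¹ ^ 2 *
      (4 * 4 * Real.sqrt (CW * (C₂' * Δ)) / H * Real.sqrt x) := by
    have hcs := ThresholdCS.sum_mul_norm_le_sqrt_mul_sqrt S hw m
    have h1 : Real.sqrt W ≤ Real.sqrt (CW * K) := Real.sqrt_le_sqrt hWle
    have h2 : Real.sqrt N2 ≤ Real.sqrt (C₂' * K * (Δ * x)) := Real.sqrt_le_sqrt hN2
    have h3 : N1 ≤ Real.sqrt (CW * K) * Real.sqrt (C₂' * K * (Δ * x)) :=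
      le_trans hcs (mul_le_mul h1 h2 (Real.sqrt_nonneg _) (Real.sqrt_nonneg _))
    set R : ℝ := Real.sqrt (CW * (C₂' * Δ)) with hR_def
    set sx : ℝ := Real.sqrt x with hsx_def
    have e : Real.sqrt (CW * K) * Real.sqrt (C₂' * K * (Δ * x)) = K * (R * sx) := by
      rw [hR_def, hsx_def, ← Real.sqrt_mul (mul_nonneg hCW0 hKpos.le),
        show CW * K * (C₂' * K * (Δ * x)) = K ^ 2 * (CW * (C₂' * Δ) * x) by ring,
        Real.sqrt_mul (sq_nonneg K), Real.sqrt_sq hKpos.le,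
        Real.sqrt_mul (mul_nonneg hCW0 (mul_nonneg hC₂'0 hΔ0.le))]
    rw [Real.sqrt_sq hHK.le]
    have hH0 : H ≠ 0 := hH.ne'
    calc τ * N1 ≤ τ * (K * (R * sx)) := by
          rw [← e]; exact mul_le_mul_of_nonneg_left h3 hτ0
      _ = H * K / 4 * x⁻¹ ^ 2 * (4 * 4 * R / H * sx) := by
          rw [hτ_def]; field_simp
  -- (iii) the second mollified moment `A₂ = Q` (real), and `Q' = (HK/4)·Q`
  have hA2 : weightAverage h K (fun k => harmonicSum (4 * (k : ℤ))
        (fun f => mollifierValue (K ^ Δ) f ^ 2 * centralValue f ^ 2)) = ((Q : ℝ) : ℂ) := by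
    rw [weightAverage_harmonicSum_eq_sum hfin h K sK hsupp, hQ_def, Complex.ofReal_sum]
    refine Finset.sum_congr rfl fun y hy => ?_
    obtain ⟨r, hr⟩ : ∃ r : ℝ, m y = (r : ℂ) := ⟨(m y).re, hm_re y hy⟩
    obtain ⟨t, ht'⟩ : ∃ t : ℝ, a y = (t : ℂ) := ⟨(a y).re, ha_re y hy⟩
    have e1 : mollifierValue (K ^ Δ) y.2 = (r : ℂ) := hr
    have e2 : centralValue y.2 = (t : ℂ) := ht'
    rw [hr, ht', e1, e2, norm_mul, mul_pow, Complex.norm_real, Complex.norm_real, Real.norm_eq_abs,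
      Real.norm_eq_abs, sq_abs, sq_abs]
    push_cast
    simp only [hw_def]
    push_cast
    ring
  have hQ2 : |Q - H * K / 4 * (16 * zetaTwo ^ 2 / (Δ * x) ^ 2 * (1 + 1 / Δ))| ≤
      C₆ * K * (Δ * x)⁻¹ ^ 3 := by
    have h6 := H6 K hK₆
    rw [hlogM, hA2, ← Complex.ofReal_sub, Complex.norm_real, Real.norm_eq_abs] at h6
    exact h6
  set Q' : ℝ := H * K / 4 * Q with hQ'_def
  have emain : 2 * zetaTwo ^ 2 * ((H * K / 4) ^ 2 / (Δ ^ 2 * x ^ 2)) * (8 * (1 + 1 / Δ)) =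
      H * K / 4 * (H * K / 4 * (16 * zetaTwo ^ 2 / (Δ * x) ^ 2 * (1 + 1 / Δ))) := by
    field_simp
    ring
  have eerr : 4 * C₆ / (H * Δ ^ 3) * (H * K / 4) ^ 2 * x⁻¹ ^ 3 =
      H * K / 4 * (C₆ * K * (Δ * x)⁻¹ ^ 3) := by
    field_simp
  have hQ'lo : 2 * zetaTwo ^ 2 * ((H * K / 4) ^ 2 / (Δ ^ 2 * x ^ 2)) * (8 * (1 + 1 / Δ)) -
      4 * C₆ / (H * Δ ^ 3) * (H * K / 4) ^ 2 * x⁻¹ ^ 3 ≤ Q' := by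
    rw [emain, eerr, hQ'_def, ← mul_sub]
    exact mul_le_mul_of_nonneg_left (by linarith [(abs_le.1 hQ2).1]) hHK.le
  have hQ'hi : Q' ≤ 2 * zetaTwo ^ 2 * ((H * K / 4) ^ 2 / (Δ ^ 2 * x ^ 2)) * (8 * (1 + 1 / Δ)) +
      4 * C₆ / (H * Δ ^ 3) * (H * K / 4) ^ 2 * x⁻¹ ^ 3 := by
    rw [emain, eerr, hQ'_def, ← mul_add]
    exact mul_le_mul_of_nonneg_left (by linarith [(abs_le.1 hQ2).2]) hHK.le
  -- (iv) Cauchy–Schwarz with the floor `τ = 4 (log K)⁻²`; `g·Q = g'·Q'` with `g' = (4/(HK))·g`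
  set g' : ℝ := 4 / (H * K) * g with hg'_def
  have hCS : τ * N1 ≤ S1 → (S1 - τ * N1) ^ 2 ≤ g' * Q' := by
    intro hle
    have h1 := ThresholdCS.floor_cauchySchwarz S hw a m hτ0 hle
    have e : g' * Q' = g * Q := by
      rw [hg'_def, hQ'_def]; field_simp
    rw [e]
    exact h1
  have hg' : (4 : ℝ) ^ 2 / (2 * (8 * (1 + 1 / Δ))) - ε / 2 ≤ g' :=
    Hx x hxx₀ ((H * K / 4) ^ 2) S1 (τ * N1) Q' g' (by positivity) hS1 ht hQ'lo hQ'hi hCS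
  have eratio : (4 : ℝ) ^ 2 / (2 * (8 * (1 + 1 / Δ))) = Δ / (1 + Δ) := by
    field_simp
    ring
  -- (v) `g ≤` the good mass with the per-weight floors `(log k)⁻²`, which is the typed left side
  have hgoal : ∑ᶠ k : ℕ, h (4 * (k : ℝ) / K) *
        ∑ᶠ f ∈ largeValueForms (4 * (k : ℤ)) (1 / Real.log k ^ 2), harmonicWeight f =
      ∑ y ∈ S with 1 / Real.log y.1 ^ 2 ≤ (centralValue y.2).re, w y :=
    weightAverage_goodMass_eq_sum hfin h K sK hsupp
  have hg_le : g ≤ ∑ y ∈ S with 1 / Real.log y.1 ^ 2 ≤ (centralValue y.2).re, w y := by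
    refine Finset.sum_le_sum_of_subset_of_nonneg ?_ (fun y hy _ => hw y (Finset.mem_filter.1 hy).1)
    intro y hy
    rw [Finset.mem_filter] at hy ⊢
    refine ⟨hy.1, ?_⟩
    have h1 := (hwin_k y.1 (hsK_win y.1 (hmemS y hy.1).1)).2.2
    have h2 : τ ≤ (a y).re := by rw [← ha_norm y hy.1]; exact hy.2
    rw [hτ_def] at h2
    exact le_trans h1 h2
  rw [hgoal]
  calc 1 / 2 - ε ≤ Δ / (1 + Δ) - ε / 2 := ratio_ge_half hε hbig
    _ = (4 : ℝ) ^ 2 / (2 * (8 * (1 + 1 / Δ))) - ε / 2 := by rw [eratio]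
    _ ≤ g' := hg'
    _ = 4 / (weightMass h * K) * g := by rw [hg'_def]
    _ ≤ 4 / (weightMass h * K) * ∑ y ∈ S with 1 / Real.log y.1 ^ 2 ≤ (centralValue y.2).re, w y :=
        mul_le_mul_of_nonneg_left hg_le (div_nonneg (by norm_num) (mul_nonneg hH.le hKpos.le))


/-- **Balkanova–Frolenkov 2021, Theorem 8.8 (corrected typing `theorem88'`) from Lemmas 8.2, 8.4,
8.6** — the literal named fact, given the displayed standard inputs.
[cite: BalkanovaFrolenkov2021, Theorem 8.8 and its proof (§8.4); Lemmas 8.2, 8.4, 8.6] -/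
theorem balkanovaFrolenkov2021_theorem88'_of_lemmas
    (h82 : balkanovaFrolenkov2021_lemma82) (h84 : balkanovaFrolenkov2021_lemma84)
    (h86 : balkanovaFrolenkov2021_lemma86)
    (hfin : ∀ k : ℤ, (primitiveForms k).Finite)
    (hmass : ∃ Cw : ℝ, ∃ kw : ℤ, ∀ k : ℤ, kw ≤ k →
      ∑ᶠ f ∈ primitiveForms k, harmonicWeight f ≤ Cw)
    (hreal : ∀ (k : ℤ) (f : CuspForm 𝒮ℒ k), f ∈ primitiveForms k → ∀ n : ℕ, (heckeLambda f n).im = 0)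
    (hKZ : ∀ (k : ℤ) (f : CuspForm 𝒮ℒ k), f ∈ primitiveForms k →
      (centralValue f).im = 0 ∧ 0 ≤ (centralValue f).re) :
    balkanovaFrolenkov2021_theorem88' :=
  balkanovaFrolenkov2021_theorem88_pos_of_lemmas h82 h84 h86 hfin hmass hreal hKZ

end LevelOneCentralValues

end Literature.NumberTheory.LFunctions

end
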